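import Summits.BirchSwinnertonDyer.BirchSwinnertonDyer.Theses.SemiOrdinaryEisensteinDescent
import Summits.BirchSwinnertonDyer.BirchSwinnertonDyer.Theses.PrintX9
import Summits.BirchSwinnertonDyer.BirchSwinnertonDyer.Theses.PrintX10b
import Summits.BirchSwinnertonDyer.BirchSwinnertonDyer.Theorems.PoitouTateSelmerStructureDualityConjHolds
import HarnessLib

set_option linter.dupNamespace false -- `…BirchSwinnertonDyer.BirchSwinnertonDyer…` is the cell's nested layout (D-0017)
set_option autoImplicit false

/-!
# Item 23092 — `PoitouTateSelmerDualityConjInput` (route `SemiOrdinaryEisensteinDescent`, support 9) = `PoitouTateSelmerDuality`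
# (routes `PrintX9`, `PrintX10b`, aside) — Poitou–Tate duality for Selmer structures, conjugation-compatible currency, every number
# field — PROVED BY NAME (LADDER-BSD D-0154 (2), INPUTS TRANCHE #3b)

Seat `bsd-inputs-honda-p1` (gen 6, idle INPUTS prover of the desk `pub/bsd-wall/bsd-inputs`), `--workitem` stmt-BirchSwinnertonDyer-23092.
THEOREMS ONLY (no definition, no named fact, no `sorry`).

The item is the named published fact `∀ K, Literature.NumberTheory.GaloisCohomology.poitouTate_selmerStructure_duality_conj K` (Milne *ADT* I
Cor. 2.3 ∧ Thm. 4.10 (b) ∧ Thm. 2.6 ∧ Howard 2004 Thm. 2.1.11 for one `Aut(K)`-compatible family of local invariant maps). It is now a THEOREM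
OF THE TREE for THE canonical family: `InputsPoitouTateSelmer.poitouTate_selmerStructure_duality_conj_holds (K)` (route-free module
`Theorems.PoitouTateSelmerStructureDualityConjHolds`: bsd-jet's `poitouTate_selmerStructure_duality_conj_of_canonical_numberField` ∘ bsd-schneider's
`unramifiedOrthogonal_of_isPerfect_allLevels` and `selmerComplement_canonical_holds`, the last landed 2026-08-28T11:03Z by door-c4 g18, p626891).
This leaf file records it against the three route declarations carrying item 23092 (one item by dedup; all `def … : Prop :=` aliases of the
signature) by `unfold; exact fun K _ _ => … K` — the desk's certified shape `T11-PT1DischargeShapes.lean` (plan-1 g9) with `hSC` discharged.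

Honest framing: UNCONDITIONAL (classical Poitou–Tate duality, kernel-checked by the `bsd-schneider` / `bsd-jet` cells). Closing item 23092
discharges the `hPTc` binder of `SemiOrdinaryEisensteinDescent`'s `closes` and conjunct 2 of `JetchevPrintFactsX9` AS TYPED only; no crux of
substance and no summit statement is proved; the Birch–Swinnerton-Dyer conjecture is NOT proved by any of this.
References: [MilneADT2006] Ch. I, Cor. 2.3, Thm. 2.6, Thm. 4.10 (b); [Howard2004HeegnerKolyvagin] Thm. 2.1.11; [MazurRubin2004] Thm. 2.3.4.
-/

namespace Summit.BirchSwinnertonDyer.BirchSwinnertonDyer.Theorems.InputsPoitouTateSelmer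

open Literature.NumberTheory.GaloisCohomology

/-- **Item 23092 on route `SemiOrdinaryEisensteinDescent` — `PoitouTateSelmerDualityConjInput` PROVED (by name):**
`∀ K, poitouTate_selmerStructure_duality_conj K` from `poitouTate_selmerStructure_duality_conj_holds`. Unconditional; closes item 23092;
BSD is not proved by this. [cite: MilneADT2006, Ch. I, Thm. 4.10 (b) (proof, p. 58), Cor. 2.3, Thm. 2.6]
[cite: Howard2004HeegnerKolyvagin, Thm. 2.1.11 (arXiv:1202.6340 p. 6)] -/
theorem semiOrdinaryEisensteinDescent_poitouTateSelmerDualityConjInput_proof :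
    Summit.BirchSwinnertonDyer.BirchSwinnertonDyer.Theses.SemiOrdinaryEisensteinDescent.PoitouTateSelmerDualityConjInput := by
  unfold Summit.BirchSwinnertonDyer.BirchSwinnertonDyer.Theses.SemiOrdinaryEisensteinDescent.PoitouTateSelmerDualityConjInput
  exact fun K _ _ => poitouTate_selmerStructure_duality_conj_holds K

/-- **Item 23092 on route `PrintX9` — `PoitouTateSelmerDuality` (aside; the same item by dedup) PROVED (by name).** Unconditional; BSD is
not proved by this. [cite: MilneADT2006, Ch. I, Thm. 4.10 (b) (proof, p. 58)] [cite: Howard2004HeegnerKolyvagin, Thm. 2.1.11 (arXiv:1202.6340 p. 6)] -/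
theorem printX9_poitouTateSelmerDuality_proof :
    Summit.BirchSwinnertonDyer.BirchSwinnertonDyer.Theses.PrintX9.PoitouTateSelmerDuality := by
  unfold Summit.BirchSwinnertonDyer.BirchSwinnertonDyer.Theses.PrintX9.PoitouTateSelmerDuality
  exact fun K _ _ => poitouTate_selmerStructure_duality_conj_holds K

/-- **Item 23092 on route `PrintX10b` — `PoitouTateSelmerDuality` (aside; the same item by dedup) PROVED (by name).** Unconditional; BSD
is not proved by this. [cite: MilneADT2006, Ch. I, Thm. 4.10 (b) (proof, p. 58)] [cite: Howard2004HeegnerKolyvagin, Thm. 2.1.11 (arXiv:1202.6340 p. 6)] -/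
theorem printX10b_poitouTateSelmerDuality_proof :
    Summit.BirchSwinnertonDyer.BirchSwinnertonDyer.Theses.PrintX10b.PoitouTateSelmerDuality := by
  unfold Summit.BirchSwinnertonDyer.BirchSwinnertonDyer.Theses.PrintX10b.PoitouTateSelmerDuality
  exact fun K _ _ => poitouTate_selmerStructure_duality_conj_holds K

end Summit.BirchSwinnertonDyer.BirchSwinnertonDyer.Theorems.InputsPoitouTateSelmer
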